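import Summits.QuantumFields.YangMills.Theses.FradkinShenkerFlow
import Summits.QuantumFields.YangMills.Theorems.FradkinShenkerFlowSusceptibilityToPoincareGibbsSparseEfronStein

/-!
# Stub `stub_tiltedShift_sq_le` (N5) of the line `rg-variance-cascade` (crux `SusceptibilityToPoincare`)

Route `FradkinShenkerFlow` of `YangMills`, crux item `stmt-QuantumFields-9441`
(`Summit.QuantumFields.YangMills.Theses.FradkinShenkerFlow.SusceptibilityToPoincare`), necessity
package "UP ⇒ TerminalPoincare", rider N5: the **one-coordinate Holley–Stroock sensitivity bound**
for a product of tilted right-invariant probability measures.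

Let `K` be a measurable group, `lam` a right-invariant probability measure on `K`, `ψ : K → ℝ`
measurable with `|ψ| ≤ B`, `ν := lam.tilted ψ` (density `e^{ψ}/Z` with respect to `lam`) and
`π := ν^{⊗ι}` the product law on `ι → K` (`ι` finite).  For a bounded measurable `Φ`, an
approximant `c` that is blind to the coordinate `e` (`c (w[e ↦ y]) = c w`) and `δ : K`,

  `(∫ Φ dπ − ∫ Φ(w[e ↦ w_e δ]) dπ(w))² ≤ 4 e^{4B} ∫ (Φ − c)² dπ`.

## Proof

* The product of the tilted factors is the product `Λ := lam^{⊗ι}` tilted by the sum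
  `Ψ(w) = Σ_i ψ(w_i)` (`GibbsSparseEfronStein.tilted_pi_sum_eq_pi_tilted`), and `Λ` is right
  invariant on the product group (`Measure.pi.isMulRightInvariant`); the shifted configuration is
  the right translate `w[e ↦ w_e δ] = w · 1[e ↦ δ]` (`TiltedShift.update_mul_eq_mul_update_one`).
* *Right shift as a density* (`TiltedShift.integral_comp_mul_right_tilted`): for a right-invariant
  `Λ` and any tilt `Ψ`, `∫ G(w d) d(Λ.tilted Ψ)(w) = ∫ e^{Ψ(v d⁻¹) − Ψ(v)} G(v) d(Λ.tilted Ψ)(v)`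
  (`integral_tilted`, `integral_mul_right_eq_self`).  Here `Ψ(v d⁻¹) − Ψ(v) = ψ(v_e δ⁻¹) − ψ(v_e)`
  (`TiltedShift.sum_mul_inv_sub_sum`), so the density ratio `r(v) = e^{ψ(v_e δ⁻¹) − ψ(v_e)}` lies in
  `(0, e^{2B}]`, whence `|1 − r| ≤ 2 e^{2B}` (`0 ≤ B` because `K` is nonempty).
* With `G := Φ − c` and `c (w[e ↦ ·]) = c w`:
  `∫ Φ dπ − ∫ Φ(w[e ↦ w_e δ]) dπ = ∫ G dπ − ∫ G(w[e ↦ w_e δ]) dπ = ∫ (1 − r) G dπ`, and by Jensen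
  (`variance_nonneg`, `variance_eq_sub`) `(∫ (1 − r) G dπ)² ≤ ∫ (1 − r)² G² dπ ≤ 4 e^{4B} ∫ G² dπ`.
Everything is bounded and measurable on probability spaces (`isProbabilityMeasure_tilted`).
-/

noncomputable section

open MeasureTheory ProbabilityTheory
open Literature.MathematicalPhysics.QuantumFieldTheory

namespace Summit.QuantumFields.YangMills.Theorems.SusceptibilityToPoincare.RgVarianceCascade

namespace TiltedShift

/-- Shifting one coordinate on the right is right multiplication, in the product group, by the
configuration `1[e ↦ δ]`: `w[e ↦ w_e δ] = w · 1[e ↦ δ]`. [folklore] -/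
theorem update_mul_eq_mul_update_one {ι K : Type*} [DecidableEq ι] [Group K] (w : ι → K)
    (e : ι) (δ : K) : Function.update w e (w e * δ) = w * Function.update (1 : ι → K) e δ := by
  ext i
  rcases eq_or_ne i e with rfl | hi
  · simp
  · simp [Function.update_of_ne hi]

/-- The sum tilt `Ψ(w) = Σ_i ψ(w_i)` changes under the right shift by `(1[e ↦ δ])⁻¹` only through
the coordinate `e`: `Ψ(v · (1[e ↦ δ])⁻¹) − Ψ(v) = ψ(v_e δ⁻¹) − ψ(v_e)`. [folklore] -/
theorem sum_mul_inv_sub_sum {ι K : Type*} [Fintype ι] [DecidableEq ι] [Group K] (ψ : K → ℝ)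
    (e : ι) (δ : K) (v : ι → K) :
    ∑ i, ψ ((v * (Function.update (1 : ι → K) e δ)⁻¹) i) - ∑ i, ψ (v i) =
      ψ (v e * δ⁻¹) - ψ (v e) := by
  rw [← Finset.sum_sub_distrib, Fintype.sum_eq_single e fun i hi => ?_]
  · simp
  · simp [Function.update_of_ne hi]

/-- **Right shift as a density** on a group with a right-invariant measure `Λ` tilted by `Ψ`:
`∫ G(w d) d(Λ.tilted Ψ)(w) = ∫ e^{Ψ(v d⁻¹) − Ψ(v)} G(v) d(Λ.tilted Ψ)(v)` — unfold both sides with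
`integral_tilted` and change variables `v = w d` in `Λ` (`integral_mul_right_eq_self`). No
integrability is needed. [folklore] -/
theorem integral_comp_mul_right_tilted {Ω : Type*} [Group Ω] [MeasurableSpace Ω]
    [MeasurableMul Ω] (Λ : Measure Ω) [Λ.IsMulRightInvariant] (Ψ G : Ω → ℝ) (d : Ω) :
    ∫ w, G (w * d) ∂(Λ.tilted Ψ) =
      ∫ v, Real.exp (Ψ (v * d⁻¹) - Ψ v) * G v ∂(Λ.tilted Ψ) := by
  rw [integral_tilted, integral_tilted]
  simp_rw [smul_eq_mul]
  have h : ∀ v, Real.exp (Ψ v) / (∫ x, Real.exp (Ψ x) ∂Λ) *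
      (Real.exp (Ψ (v * d⁻¹) - Ψ v) * G v) =
      Real.exp (Ψ (v * d⁻¹)) / (∫ x, Real.exp (Ψ x) ∂Λ) * G v := fun v => by
    have hne : Real.exp (Ψ v) ≠ 0 := (Real.exp_pos _).ne'
    rw [Real.exp_sub]
    calc Real.exp (Ψ v) / (∫ x, Real.exp (Ψ x) ∂Λ) *
          (Real.exp (Ψ (v * d⁻¹)) / Real.exp (Ψ v) * G v)
        = Real.exp (Ψ v) / Real.exp (Ψ v) *
          (Real.exp (Ψ (v * d⁻¹)) / (∫ x, Real.exp (Ψ x) ∂Λ) * G v) := by ring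
      _ = _ := by rw [div_self hne, one_mul]
  simp_rw [h]
  rw [← integral_mul_right_eq_self
    (fun v => Real.exp (Ψ (v * d⁻¹)) / (∫ x, Real.exp (Ψ x) ∂Λ) * G v) d]
  simp_rw [mul_inv_cancel_right]

/-- **Right shift of one coordinate as a density, on a product of tilted measures**: for a
right-invariant σ-finite `lam` on the group `K`, a tilt `ψ`, the product `π = (lam.tilted ψ)^{⊗ι}`
and any `G`, `∫ G(w[e ↦ w_e δ]) dπ(w) = ∫ e^{ψ(v_e δ⁻¹) − ψ(v_e)} G(v) dπ(v)`: the product of the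
tilted factors is `lam^{⊗ι}` tilted by `Σ_i ψ(w_i)` (`GibbsSparseEfronStein.tilted_pi_sum_eq_pi_tilted`),
`lam^{⊗ι}` is right invariant, and `integral_comp_mul_right_tilted` applies to the right translate
`w · 1[e ↦ δ]`. [folklore] -/
theorem integral_comp_update_pi_tilted {ι K : Type*} [Fintype ι] [DecidableEq ι] [Group K]
    [MeasurableSpace K] [MeasurableMul K] (lam : Measure K) [SigmaFinite lam]
    [lam.IsMulRightInvariant] (ψ : K → ℝ) (G : (ι → K) → ℝ) (e : ι) (δ : K) :
    ∫ w, G (Function.update w e (w e * δ)) ∂Measure.pi (fun _ : ι => lam.tilted ψ) =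
      ∫ v, Real.exp (ψ (v e * δ⁻¹) - ψ (v e)) * G v ∂Measure.pi (fun _ : ι => lam.tilted ψ) := by
  have hπ : Measure.pi (fun _ : ι => lam.tilted ψ) =
      (Measure.pi fun _ : ι => lam).tilted (fun w => ∑ i, ψ (w i)) :=
    (GibbsSparseEfronStein.tilted_pi_sum_eq_pi_tilted (fun _ : ι => lam) (fun _ : ι => ψ)).symm
  simp_rw [update_mul_eq_mul_update_one]
  rw [hπ, integral_comp_mul_right_tilted (Measure.pi fun _ : ι => lam) (fun w => ∑ i, ψ (w i)) G
    (Function.update (1 : ι → K) e δ)]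
  refine integral_congr_ae (ae_of_all _ fun v => ?_)
  simp only [sum_mul_inv_sub_sum]

end TiltedShift

/-- `stub_tiltedShift_sq_le` (rider N5 of the line `rg-variance-cascade`) — **one-coordinate
Holley–Stroock sensitivity bound on a product of tilted right-invariant probability measures**.
For a measurable group `K`, a right-invariant probability measure `lam`, a measurable tilt `ψ` with
`|ψ| ≤ B`, the product `π = (lam.tilted ψ)^{⊗ι}`, a bounded measurable `Φ`, a bounded measurable
`c` blind to the coordinate `e` and `δ : K`:
`(∫ Φ dπ − ∫ Φ(w[e ↦ w_e δ]) dπ)² ≤ 4 e^{4B} ∫ (Φ − c)² dπ`.  The right shift of coordinate `e`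
has density `r = e^{ψ(v_e δ⁻¹) − ψ(v_e)} ∈ (0, e^{2B}]` against `π`
(`TiltedShift.integral_comp_update_pi_tilted`), the difference equals `∫ (1 − r)(Φ − c) dπ`
because `c` is shift invariant, and Jensen (`variance_nonneg`) gives the bound with
`(1 − r)² ≤ 4 e^{4B}`. [folklore] -/
theorem stub_tiltedShift_sq_le :
    ∀ (ι : Type) [Fintype ι] [DecidableEq ι] (K : Type) [Group K] [MeasurableSpace K]
      [MeasurableMul₂ K] (lam : Measure K) [IsProbabilityMeasure lam] [lam.IsMulRightInvariant]
      (ψ : K → ℝ), Measurable ψ → ∀ (Bψ : ℝ), (∀ k, |ψ k| ≤ Bψ) →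
      ∀ (Φ : (ι → K) → ℝ), Measurable Φ → (∃ M : ℝ, ∀ w, |Φ w| ≤ M) →
      ∀ (c : (ι → K) → ℝ), Measurable c → (∃ M : ℝ, ∀ w, |c w| ≤ M) →
      ∀ (e : ι), (∀ w y, c (Function.update w e y) = c w) → ∀ (δ : K),
      (∫ w, Φ w ∂Measure.pi (fun _ : ι => lam.tilted ψ) -
          ∫ w, Φ (Function.update w e (w e * δ)) ∂Measure.pi (fun _ : ι => lam.tilted ψ)) ^ 2 ≤
        4 * Real.exp (4 * Bψ) * ∫ w, (Φ w - c w) ^ 2 ∂Measure.pi (fun _ : ι => lam.tilted ψ) := by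
  intro ι _ _ K _ _ _ lam _ _ ψ hψ B hB Φ hΦ hΦb c hc hcb e hce δ
  obtain ⟨MΦ, hMΦ⟩ := hΦb
  obtain ⟨Mc, hMc⟩ := hcb
  -- the tilted factor, hence the product, is a probability measure
  have hB0 : 0 ≤ B := (abs_nonneg _).trans (hB 1)
  have hexp : Integrable (fun k => Real.exp (ψ k)) lam := by
    refine Integrable.of_bound (Real.measurable_exp.comp hψ).aestronglyMeasurable (Real.exp B)
      (ae_of_all _ fun k => ?_)
    rw [Real.norm_eq_abs, Real.abs_exp]
    exact Real.exp_le_exp.2 ((le_abs_self _).trans (hB k))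
  haveI : IsProbabilityMeasure (lam.tilted ψ) := isProbabilityMeasure_tilted hexp
  set π : Measure (ι → K) := Measure.pi (fun _ : ι => lam.tilted ψ) with hπ
  -- the density ratio of the shift
  obtain ⟨r, hr⟩ : ∃ r : (ι → K) → ℝ, r = fun v => Real.exp (ψ (v e * δ⁻¹) - ψ (v e)) := ⟨_, rfl⟩
  have hrm : Measurable r := by
    rw [hr]
    exact Real.measurable_exp.comp
      ((hψ.comp ((measurable_pi_apply e).mul_const _)).sub (hψ.comp (measurable_pi_apply e)))
  have hr0 : ∀ v, 0 < r v := fun v => by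
    rw [hr]
    exact Real.exp_pos _
  have hr1 : ∀ v, r v ≤ Real.exp (2 * B) := fun v => by
    rw [hr]
    refine Real.exp_le_exp.2 ?_
    have h1 := (abs_le.1 (hB (v e * δ⁻¹))).2
    have h2 := (abs_le.1 (hB (v e))).1
    linarith
  have habs : ∀ v, |1 - r v| ≤ 2 * Real.exp (2 * B) := fun v => by
    have h1B : 1 ≤ Real.exp (2 * B) := Real.one_le_exp (by linarith)
    rw [abs_le]
    constructor <;> linarith [hr0 v, hr1 v]
  -- the shift identity for `G := Φ - c`
  have hshift : ∫ w, (Φ (Function.update w e (w e * δ)) - c (Function.update w e (w e * δ))) ∂π =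
      ∫ v, r v * (Φ v - c v) ∂π := by
    rw [hr]
    exact TiltedShift.integral_comp_update_pi_tilted lam ψ (fun w => Φ w - c w) e δ
  -- integrability of the bounded measurable integrands
  have hupdm : Measurable fun w : ι → K => Function.update w e (w e * δ) := by
    have h : (fun w : ι → K => Function.update w e (w e * δ)) =
        fun w => w * Function.update (1 : ι → K) e δ :=
      funext fun w => TiltedShift.update_mul_eq_mul_update_one w e δ
    rw [h]
    exact measurable_mul_const _
  have hint : ∀ {f : (ι → K) → ℝ}, Measurable f → ∀ M : ℝ, (∀ w, |f w| ≤ M) → Integrable f π :=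
    fun hf M hM => Integrable.of_bound hf.aestronglyMeasurable M
      (ae_of_all _ fun w => by rw [Real.norm_eq_abs]; exact hM w)
  have hGb : ∀ w, |Φ w - c w| ≤ MΦ + Mc := fun w =>
    (abs_sub _ _).trans (add_le_add (hMΦ w) (hMc w))
  have hΦi : Integrable Φ π := hint hΦ MΦ hMΦ
  have hΦui : Integrable (fun w => Φ (Function.update w e (w e * δ))) π :=
    hint (hΦ.comp hupdm) MΦ fun w => hMΦ _
  have hGi : Integrable (fun w => Φ w - c w) π := hint (hΦ.sub hc) (MΦ + Mc) hGb
  have hGui : Integrable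
      (fun w => Φ (Function.update w e (w e * δ)) - c (Function.update w e (w e * δ))) π :=
    hint ((hΦ.comp hupdm).sub (hc.comp hupdm)) (MΦ + Mc) fun w => hGb _
  have hrGi : Integrable (fun v => r v * (Φ v - c v)) π := by
    refine hint (hrm.mul (hΦ.sub hc)) (Real.exp (2 * B) * (MΦ + Mc)) fun v => ?_
    rw [abs_mul, abs_of_pos (hr0 v)]
    exact mul_le_mul (hr1 v) (hGb v) (abs_nonneg _) (Real.exp_pos _).le
  -- the difference of the two means as one integral against `(1 - r) (Φ - c)`
  have hdiff : ∫ w, Φ w ∂π - ∫ w, Φ (Function.update w e (w e * δ)) ∂π =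
      ∫ v, (1 - r v) * (Φ v - c v) ∂π := by
    have h1 : ∫ w, Φ w ∂π - ∫ w, Φ (Function.update w e (w e * δ)) ∂π =
        ∫ w, (Φ w - c w) ∂π -
          ∫ w, (Φ (Function.update w e (w e * δ)) - c (Function.update w e (w e * δ))) ∂π := by
      rw [← integral_sub hΦi hΦui, ← integral_sub hGi hGui]
      refine integral_congr_ae (ae_of_all _ fun w => ?_)
      dsimp only
      rw [hce]
      ring
    rw [h1, hshift, ← integral_sub hGi hrGi]
    refine integral_congr_ae (ae_of_all _ fun w => ?_)
    ring
  rw [hdiff]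
  -- Jensen and the pointwise bound `(1 - r)² ≤ 4 e^{4B}`
  have hX : MemLp (fun v => (1 - r v) * (Φ v - c v)) 2 π := by
    refine MemLp.of_bound ((measurable_const.sub hrm).mul (hΦ.sub hc)).aestronglyMeasurable
      (2 * Real.exp (2 * B) * (MΦ + Mc)) (ae_of_all _ fun v => ?_)
    rw [Real.norm_eq_abs, abs_mul]
    exact mul_le_mul (habs v) (hGb v) (abs_nonneg _) (by positivity)
  have hJ : (∫ v, (1 - r v) * (Φ v - c v) ∂π) ^ 2 ≤ ∫ v, ((1 - r v) * (Φ v - c v)) ^ 2 ∂π := by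
    have h0 := variance_nonneg (fun v => (1 - r v) * (Φ v - c v)) π
    rw [variance_eq_sub hX] at h0
    simp only [Pi.pow_apply] at h0
    linarith
  have hGm : MemLp (fun v => Φ v - c v) 2 π :=
    MemLp.of_bound (hΦ.sub hc).aestronglyMeasurable (MΦ + Mc)
      (ae_of_all _ fun v => by rw [Real.norm_eq_abs]; exact hGb v)
  have he4 : (2 * Real.exp (2 * B)) ^ 2 = 4 * Real.exp (4 * B) := by
    have h : Real.exp (4 * B) = Real.exp (2 * B) * Real.exp (2 * B) := by
      rw [← Real.exp_add]
      congr 1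
      ring
    rw [h]
    ring
  have hpt : ∀ v, ((1 - r v) * (Φ v - c v)) ^ 2 ≤ 4 * Real.exp (4 * B) * (Φ v - c v) ^ 2 :=
    fun v => by
    rw [mul_pow, ← he4]
    refine mul_le_mul_of_nonneg_right ?_ (sq_nonneg _)
    calc (1 - r v) ^ 2 = |1 - r v| ^ 2 := (sq_abs _).symm
      _ ≤ (2 * Real.exp (2 * B)) ^ 2 := pow_le_pow_left₀ (abs_nonneg _) (habs v) 2
  calc (∫ v, (1 - r v) * (Φ v - c v) ∂π) ^ 2
      ≤ ∫ v, ((1 - r v) * (Φ v - c v)) ^ 2 ∂π := hJ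
    _ ≤ ∫ v, 4 * Real.exp (4 * B) * (Φ v - c v) ^ 2 ∂π :=
        integral_mono hX.integrable_sq (hGm.integrable_sq.const_mul _) hpt
    _ = 4 * Real.exp (4 * B) * ∫ w, (Φ w - c w) ^ 2 ∂π := integral_const_mul _ _

end Summit.QuantumFields.YangMills.Theorems.SusceptibilityToPoincare.RgVarianceCascade

end
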